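import Literature.NumberTheory.Sieve.GrimmeltMerikoski2025
import HarnessLib

/-!
# The greatest prime factor of `n² + 1`: the rung `P⁺(n² + 1) > n^ϖ` and the record `1.312`

Topic `Literature/NumberTheory/Sieve` (sibling of `GrimmeltMerikoski2025.lean`, whose «What is NOT
here» lists Theorem 1.1 of [GrimmeltMerikoski2025]; and of `LargestPrimeFactorCubic.lean`, the
analogous statements for `n³ + 2`).

* `NsqLargePrimeFactor ϖ` — the RUNG «the greatest prime factor of `n² + 1` exceeds `n^ϖ` for
  infinitely many `n`», the shape of [Merikoski2022, Theorem 1] («The largest prime factor of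
  `n² + 1` is greater than `n^{1.279}` for infinitely many integers `n`»; arXiv:1908.08816, same
  numbering) and of the records of Chebyshev–Hooley (`1.10014…`), Deshouillers–Iwaniec
  (`1.202468…`), de la Bretèche–Drappeau (`1.2182`) quoted there; API: `NsqLargePrimeFactor.mono`
  (antitone in `ϖ`) and the non-vacuous floor `nsqLargePrimeFactor_of_nonpos`.
* NAMED FACT `GM2025.grimmeltMerikoski2025_thm11_one` — [GrimmeltMerikoski2025, Theorem 1.1]
  SPECIALISED to `a = h = 1`, AS PRINTED: «there exists some small `ε > 0` such that for all
  `X > ε⁻¹` … suppose that for any `X^ε < Y < Z ≤ X²` we have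
  `∑_{Y ≤ p < Z} (log p/p) ϱ_{a,h}(p) ≤ (1 + ε) log Z/Y + 1/ε`. Then there exists `n ∈ [X, 2X]` such
  that the greatest prime factor of `an² + h` is greater than `X^{1.312}`» — the hypothesis on
  `ϱ_{1,1}(p) = 1 + (−1/p)` (tree `GM2025.rho 1 1`) is KEPT as printed (the paper remarks, p. 3 of the
  arXiv render: «For `ah ≤ X^{ε²}` the hypothesis can be shown unconditionally by the classical
  zero-free region», i.e. for `n² + 1` it is Mertens' theorem for the primes `p ≡ 1 (mod 4)`; it is not
  discharged here). `TODO(general form)`: `1 ≤ h ≤ X^{1+ε}` square-free, `1 ≤ a ≤ X^ε`, `(a, h) = 1`.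
* PROVED `nsqLargePrimeFactor_of_thm11`: Theorem 1.1 (with its hypothesis granted eventually in
  `X`) gives `NsqLargePrimeFactor ϖ` for every `ϖ < 1.312` — NOT literally at `ϖ = 1.312`: the
  printed conclusion is `P⁺ > X^{1.312}` for some `n ∈ [X, 2X]`, i.e. `P⁺ > (n/2)^{1.312}`; the
  `n`-form at the exponent `1.312` itself is [Merikoski2022, Theorem 2], CONDITIONAL on Selberg's
  eigenvalue conjecture («Assuming Selberg's eigenvalue conjecture the exponent `1.279` in Theorem 1
  may be increased to `1.312`»), and the abstract-level sentence of [GrimmeltMerikoski2025] («at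
  least `n^{1.312}` infinitely often»).  Consumers wanting the rung at `1.312` exactly must carry it
  as their own item (the parity-ideate cell's certified re-derivation, FINDINGS-P3-R11, reads the
  printed decomposition as giving every `ϖ < 1.3171`).

Written for the parity-ideate cell (planner p3's «Suggested tree action», ROUND-11; literature seat
g15, 2026-08-27).  One new named fact (Theorem 1.1, `a = h = 1`); everything else proved.

## References

* [GrimmeltMerikoski2025] L. Grimmelt, J. Merikoski, *On the greatest prime factor and uniform
  equidistribution of quadratic polynomials*, arXiv:2505.00493 (2025): Theorem 1.1 (p. 3 of the
  render `parity-ideate-lit/renders/paper-arxiv-2505.00493/p0003.txt`, L13–L20), the definition of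
  `ϱ_{a,h}` before it, and the remark after it.
* [Merikoski2022] J. Merikoski, *On the largest prime factor of n² + 1*, J. Eur. Math. Soc. 25
  (2023) 1253–1284 (arXiv:1908.08816): Theorem 1 (`1.279`), Theorem 2 (`1.312` under Selberg's
  eigenvalue conjecture), §1 (history).

## Mathlib / tree search

Tree: `GM2025.rho` / `rho_one_one` (`GrimmeltMerikoski2025`), `polyRootCountMod` (`BatemanHorn`);
the `n³ + 2` analogue `cubicLargePrimeFactorCount`, `HeathBrown2001_largestPrimeFactor_cubic`
(`LargestPrimeFactorCubic`). `lean search 'LargePrimeFactor|largestPrimeFactor|greatestPrimeFactor'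
--decl`: only `Barriers/ABC/….largestPrimeFactor` (the arithmetic function) and the cubic files — no
`n² + 1` rung before this file. Mathlib: `Nat.exists_prime_and_dvd`, `Real.rpow_le_rpow_of_exponent_le`,
`Real.rpow_le_one_of_one_le_of_nonpos`, `tendsto_rpow_atTop`, `Filter.frequently_atTop`.
-/

noncomputable section

open Filter Finset

namespace Literature.NumberTheory.Sieve

/-! ### The rung -/

/-- **The rung «`P⁺(n² + 1) > n^ϖ` infinitely often»** (a family of statements indexed by the
exponent `ϖ`; a THEOREM for `ϖ ≤ 1.279` by the cited source, trivially for `ϖ ≤ 0` below): for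
infinitely many `n` some prime `p ∣ n² + 1` satisfies `p > n^ϖ` (records: Chebyshev–Hooley
`ϖ = 1.10014…`, Deshouillers–Iwaniec `1.202468…`, de la Bretèche–Drappeau `1.2182`, Merikoski `1.279`;
Grimmelt–Merikoski `1.312` in the `X`-form below).
[cite: Merikoski2022, Theorem 1 (the statement shape «greater than n^{1.279} for infinitely many integers n»)] -/
def NsqLargePrimeFactor (ϖ : ℝ) : Prop :=
  ∃ᶠ n : ℕ in atTop, ∃ p : ℕ, p.Prime ∧ p ∣ n ^ 2 + 1 ∧ (n : ℝ) ^ ϖ < p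

/-- `NsqLargePrimeFactor` unfolded. [cite: Merikoski2022, Theorem 1] -/
theorem nsqLargePrimeFactor_iff (ϖ : ℝ) :
    NsqLargePrimeFactor ϖ ↔ ∃ᶠ n : ℕ in atTop, ∃ p : ℕ, p.Prime ∧ p ∣ n ^ 2 + 1 ∧ (n : ℝ) ^ ϖ < p :=
  Iff.rfl

/-- The rung is antitone in the exponent: `ϖ' ≤ ϖ` and `P⁺(n²+1) > n^ϖ` i.o. give
`P⁺(n²+1) > n^{ϖ'}` i.o. (`n^{ϖ'} ≤ n^ϖ` for `n ≥ 1`). [cite: Merikoski2022, Theorem 1 and §1 (the increasing records)] -/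
theorem NsqLargePrimeFactor.mono {ϖ ϖ' : ℝ} (h : ϖ' ≤ ϖ) (hϖ : NsqLargePrimeFactor ϖ) :
    NsqLargePrimeFactor ϖ' := by
  refine (hϖ.and_eventually (eventually_ge_atTop 1)).mono ?_
  rintro n ⟨⟨p, hp, hdvd, hlt⟩, hn⟩
  refine ⟨p, hp, hdvd, lt_of_le_of_lt ?_ hlt⟩
  exact Real.rpow_le_rpow_of_exponent_le (by exact_mod_cast hn) h

/-- Non-vacuity: for `ϖ ≤ 0` the rung holds trivially (`n^ϖ ≤ 1 < 2 ≤ p` for any prime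
`p ∣ n² + 1`, `n ≥ 1`; sanity check of the definition). [cite: Merikoski2022, §1 (all records have ϖ > 1)] -/
theorem nsqLargePrimeFactor_of_nonpos {ϖ : ℝ} (h : ϖ ≤ 0) : NsqLargePrimeFactor ϖ := by
  refine Filter.Eventually.frequently ?_
  filter_upwards [eventually_ge_atTop 1] with n hn
  have hne : n ^ 2 + 1 ≠ 1 := by
    have : 1 ≤ n ^ 2 := Nat.one_le_pow _ _ hn
    omega
  obtain ⟨p, hp, hdvd⟩ := Nat.exists_prime_and_dvd hne
  refine ⟨p, hp, hdvd, ?_⟩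
  calc (n : ℝ) ^ ϖ ≤ 1 := Real.rpow_le_one_of_one_le_of_nonpos (by exact_mod_cast hn) h
    _ < p := by exact_mod_cast hp.one_lt

/-! ### Grimmelt–Merikoski 2025, Theorem 1.1 for `n² + 1` -/

namespace GM2025

/-- **Grimmelt–Merikoski 2025, Theorem 1.1, for `a = h = 1`** (AS PRINTED, hypothesis kept):
there is `ε > 0` such that for every `X > ε⁻¹`, IF `∑_{Y ≤ p < Z} (log p/p) ϱ_{1,1}(p) ≤
(1 + ε) log(Z/Y) + ε⁻¹` for all `X^ε < Y < Z ≤ X²` (`ϱ_{1,1}(p) = #{ν mod p : ν² + 1 ≡ 0}`, tree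
`rho 1 1`), THEN some `n ∈ [X, 2X]` has a prime factor `p ∣ n² + 1` with `p > X^{1.312}`.
`TODO(general form)`: `an² + h`, `1 ≤ h ≤ X^{1+ε}` square-free, `1 ≤ a ≤ X^ε`, `(a,h) = 1`.
[cite: GrimmeltMerikoski2025, Theorem 1.1] -/
def grimmeltMerikoski2025_thm11_one : Prop :=
  ∃ ε : ℝ, 0 < ε ∧ ∀ X : ℝ, ε⁻¹ < X →
    (∀ Y Z : ℝ, X ^ ε < Y → Y < Z → Z ≤ X ^ 2 →
        ∑ p ∈ (Iic ⌊Z⌋₊).filter (fun p : ℕ => p.Prime ∧ Y ≤ (p : ℝ) ∧ (p : ℝ) < Z),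
          Real.log p / p * (rho 1 1 p : ℝ) ≤ (1 + ε) * Real.log (Z / Y) + ε⁻¹) →
    ∃ n : ℕ, X ≤ (n : ℝ) ∧ (n : ℝ) ≤ 2 * X ∧
      ∃ p : ℕ, p.Prime ∧ p ∣ n ^ 2 + 1 ∧ X ^ (1.312 : ℝ) < (p : ℝ)

/-- **What Theorem 1.1 gives on the rung**: if its Mertens-type hypothesis for `ϱ_{1,1}` holds for
all large `X` (classical for `n² + 1`: primes `p ≡ 1 (mod 4)`; an explicit hypothesis here), then
`P⁺(n² + 1) > n^ϖ` infinitely often for every `ϖ < 1.312` (from `p > X^{1.312} ≥ (2X)^ϖ ≥ n^ϖ`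
for `X` large; the exponent `1.312` itself in the `n`-form is [Merikoski2022, Thm 2], conditional).
[cite: GrimmeltMerikoski2025, Theorem 1.1 and the remark following it] -/
theorem nsqLargePrimeFactor_of_thm11 (hGM : grimmeltMerikoski2025_thm11_one)
    (hρ : ∀ ε : ℝ, 0 < ε → ∀ᶠ X : ℝ in atTop, ∀ Y Z : ℝ, X ^ ε < Y → Y < Z → Z ≤ X ^ 2 →
        ∑ p ∈ (Iic ⌊Z⌋₊).filter (fun p : ℕ => p.Prime ∧ Y ≤ (p : ℝ) ∧ (p : ℝ) < Z),
          Real.log p / p * (rho 1 1 p : ℝ) ≤ (1 + ε) * Real.log (Z / Y) + ε⁻¹)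
    {ϖ : ℝ} (hϖ : ϖ < 1.312) : NsqLargePrimeFactor ϖ := by
  rcases le_or_gt ϖ 0 with hϖ0 | hϖ0
  · exact nsqLargePrimeFactor_of_nonpos hϖ0
  obtain ⟨ε, hε, hX⟩ := hGM
  rw [nsqLargePrimeFactor_iff, frequently_atTop]
  intro N
  -- `(2X)^ϖ ≤ X^{1.312}` for all large `X`: `2^ϖ ≤ X^{1.312 − ϖ}`
  have hδ : 0 < (1.312 : ℝ) - ϖ := by linarith
  have h2 : ∀ᶠ X : ℝ in atTop, (2 : ℝ) ^ ϖ ≤ X ^ ((1.312 : ℝ) - ϖ) :=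
    (tendsto_rpow_atTop hδ).eventually_ge_atTop _
  obtain ⟨X, hρX, h2X, hXN⟩ :=
    ((hρ ε hε).and (h2.and (eventually_gt_atTop (max (N : ℝ) ε⁻¹)))).exists
  have hXε : ε⁻¹ < X := (le_max_right _ _).trans_lt hXN
  have hXNr : (N : ℝ) < X := (le_max_left _ _).trans_lt hXN
  have hX0 : 0 < X := lt_trans (inv_pos.mpr hε) hXε
  obtain ⟨n, hXn, hn2X, p, hp, hdvd, hlt⟩ := hX X hXε hρX
  refine ⟨n, ?_, p, hp, hdvd, ?_⟩
  · exact_mod_cast hXNr.le.trans hXn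
  · -- `n^ϖ ≤ (2X)^ϖ = 2^ϖ X^ϖ ≤ X^{1.312 − ϖ} X^ϖ = X^{1.312} < p`
    have hn0 : (0 : ℝ) ≤ n := Nat.cast_nonneg n
    calc (n : ℝ) ^ ϖ ≤ (2 * X) ^ ϖ := Real.rpow_le_rpow hn0 hn2X hϖ0.le
      _ = (2 : ℝ) ^ ϖ * X ^ ϖ := Real.mul_rpow (by norm_num) hX0.le
      _ ≤ X ^ ((1.312 : ℝ) - ϖ) * X ^ ϖ :=
          mul_le_mul_of_nonneg_right h2X (Real.rpow_nonneg hX0.le _)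
      _ = X ^ (1.312 : ℝ) := by
          rw [← Real.rpow_add hX0]; ring_nf
      _ < p := hlt

end GM2025

end Literature.NumberTheory.Sieve

end
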